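import Mathlib
import Literature.MathematicalPhysics.QuantumFieldTheory.Balaban1983to89.B10SectAGathering

/-!
# `Balaban1983to89.B10Eq24Cumulant` — [Balaban1985UV3] (24) p. 262 / (58) p. 270 ← [Balaban1982Higgs1] (3.23)–(3.24)
# p. 616: the CUMULANT EXPANSION «up to the sixth order» as an EXACT Taylor–Lagrange identity for
# `t ↦ log ∫ e^{tV} d(χμ)`; the truncated expectations `⟨Vⁿ⟩ᵀ` DEFINED and COMPUTED (orders 1–4 — the printed third
# formula of B1 p. 616 is a misprint, kernel witness); the χ-bookkeeping (the volume of χ is needed DOWNSTAIRS only);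
# and the typed leaves `B10SectAGathering.Cumulant58` / `CumulantLower` discharged MODULO three NAMED hypothesis
# shapes — kernel-checked; no object of the series is constructed, nothing of it is asserted

T. Bałaban, *Ultraviolet stability of three-dimensional lattice pure gauge field theories*, Commun. Math. Phys. **102**,
255–275 (1985) [Balaban1985UV3] (cell paper B10; PDF `paper:balaban1985-cmp102-uv-stability-3d`, journal page = PDF
page + 254); its reference [8] = T. Bałaban, *(Higgs)₂,₃ quantum fields in a finite volume. I. A lower bound*, Commun.
Math. Phys. **85**, 603–636 (1982) [Balaban1982Higgs1] (cell paper B1; journal page = PDF page + 602).  Sibling of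
`…Balaban1983to89.B10SectAGathering` (imported: the bookkeeping structure `StepPieces` of one renormalization step and
its typed leaves `Cumulant58` = (24)/(58)–(59) `logFl ≤ PprU + Cz·g_k·|Z_k| + C·rem` and `CumulantLower` = the lower
direction at the trivial history) and hence of `…Balaban1983to89.B10` (`TowerRun`: histories `Hist`, configurations
`Cfg`, the running coupling `g`, the trivial history `triv`).  No module of the T4 node is imported; the only engine is
Mathlib's `ProbabilityTheory.mgf` / `cgf` / `Measure.tilted` calculus and
`taylor_mean_remainder_lagrange_iteratedDeriv`.

WHY THIS MODULE (cell GAPS G-adv5-3, objection GAP-ROUTINE — by-reference to a by-reference: the imported cumulant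
lemma's hypotheses are stated in neither B1 nor B10, "a statement is owed"; cross-references G-adv9-64 (c)/(d),
C-b10g6-1 (the leaves `Cumulant58` / `CumulantLower`), C-b10g13-1 (`B10Eq47Volume`)).  B10 computes the fluctuation
integral of every step by "the cumulant expansion formula (3.24) [8]"; [8] = B1 proves (3.24) only by pointing to
Benfatto, Cassandro, Gallavotti, Nicolò, Olivieri, Presutti, Scacciatelli, Commun. Math. Phys. 59 (1978) 143–166,
"the lemma formulated on p. 152" (NOT held — acquisition request acq-07983 — not opened, not used here), or to "the
method used by Gawędzki and Kupiainen".  What a kernel CAN settle without that lemma is the whole ALGEBRAIC and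
CALCULUS skeleton of (3.23)–(3.24), leaving exactly ONE analytic statement as the owed lemma:
 (i) the truncated expectations are DEFINED — B1 introduces them only through the formal identity (3.23) and two
     examples — as the Taylor coefficients at 0 of the cumulant generating function `f(t) = log ∫ e^{tV} dν`
     (`truncExp`; the textbook definition, secondary locator [Gallavotti1985] (5.10) *"given p random variables
     x₁, …, x_p and p positive integers n₁, …, n_p one defines the truncated expectations of x₁, …, x_p as
     ℰᵀ(x₁, …, x_p; n₁, …, n_p) = ∂^{n₁+…+n_p}/(∂λ₁^{n₁}…∂λ_p^{n_p}) log ℰ(e^{λ₁x₁+…+λ_px_p})|_{λᵢ=0}"* and (5.13)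
     *"Therefore the following Taylor expansion, cumulant expansion, formally holds
     ℰ(eˣ) = exp Σ_{p=1}^∞ (1/p!)ℰᵀ(x;p)"*);
 (ii) the moment–cumulant recursion (Leibniz on `Z′ = f′·Z`, `Z(t) = ∫ e^{tV} dν`) and the displayed low orders are
     COMPUTED — and the printed third one is found WRONG: B1 p. 616 prints `+ ⟨V⟩³` where the coefficient is 2
     (`truncExp_three`; kernel witness `printedThird_ne`: V ≡ 1 on a point has ⟨V³⟩ᵀ = 0, the printed right side is −1).
     A misprint, immaterial to either paper (no coefficient of (3.23) is used numerically) — cell DIVERGENCE D-b10.19;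
 (iii) (3.24) truncated at ANY order N is Taylor's theorem with Lagrange remainder for the real-analytic `f` on [0, 1]
     (`cgf_taylor_lagrange`): an IDENTITY `log ∫e^{V}dν − log ν(univ) = Σ_{n=1}^{N} ⟨Vⁿ⟩ᵀ/n! + f⁽ᴺ⁺¹⁾(θ)/(N+1)!` whose
     remainder coefficient `f⁽ᴺ⁺¹⁾(θ)` is — "tilting = shifting", `truncExp_tilted` — the (N+1)-st truncated expectation
     of V under the interpolating law `e^{θV}ν/Z(θ)`.  The CONTENT of (3.24) is then the single statement that THIS
     quantity is `O(εᵏ)|T₁|`, VOLUME-LINEAR (B1: "connected graphs with exponentially decaying propagators") — typed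
     here as the hypothesis shape `FluctuationModel.CumulantRemainderBound` and never asserted;
 (iv) the rôle of χ is separated exactly: with `ν = χ·μ` (μ the Gaussian probability measure, `0 ≤ χ ≤ 1`; §4b) the
     total mass is `⟨χ⟩ ≤ 1`, so `f(0) = log⟨χ⟩ ≤ 0` and the UPPER half of (3.24) — all that (24) and (58) use, both are
     «≦» — needs NO information on the volume of χ (`log_integral_exp_le`, `log_integral_chi_exp_le`), while the LOWER
     half ((37) p. 265 / (47) p. 267) needs precisely `log⟨χ⟩ ≥ −O(rem)` (`le_log_integral_exp`), the clause of
     G-adv9-64 (c) certified GIVEN Šidák in `…B10Eq47Volume` (NOT imported; consumed here only as the hypothesis shape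
     `FluctuationModel.SmallFieldVolume`).
The B10-facing §5 then discharges the tree leaves `Cumulant58` / `CumulantLower` from a dictionary structure
`FluctuationModel` (data + the two printed seventh-order-remainder sandwiches) and three named leaves — pure
bookkeeping (`linarith`), every analytic input a binder.

CITATION HEADER (lean-in-tree rule).  WHAT IS REPRODUCED, verbatim from the renders READ AS IMAGES for this module
(B10 p. 261 [PDF 7], p. 262 [PDF 8], p. 265 [PDF 11], p. 270 [PDF 16], p. 272 [PDF 18]; B1 p. 616 [PDF 14]):
* B10 p. 261–262, after (22) (whose last factor is `∫dμ_{C^{(0)}(Ω₁,U₁)}(A)χ exp[𝓋(g₀A) − (1/g₀²)Ṽ(g₀A)]`, *"where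
  χ = Π_{b∈Ω₁} χ({|A(b)| < p²(g₀)})"*): *"The last integral above has the form ∫μχ exp V* ⟦sic⟧*, where dμ is a
  Gaussian measure with a covariance having an exponential decay property (and many other properties, see Sect. E in
  [5]), and V is a sum of terms with good localization properties. This integral can be expressed naturally by an
  exponentiated cluster expansion, but we use here the major simplification coming from the fact that the model is
  superrenormalizable and the scaled coupling constant g₀ is proportional to a positive power of ε, g₀ = gε^{1/2}.
  Using the ideas and methods of [11, 12, 8, 9] we expand 𝓋(g₀A) − 1/g₀²Ṽ(g₀A) up to the sixth order (or higher) in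
  g₀, and we estimate the remainder by O(g₀⁷p¹⁸(g₀))|Ω₁| ≦ O(ε^{3+κ₀})|T₁|, κ₀ > 0. Next, the integral is calculated
  by the cumulant expansion formula (3.24) [8], again up to the sixth order in g₀. A result of the calculation can be
  represented by lower order connected vacuum graphs with vertices determined by the expansions of the function
  𝓋(g₀A) − 1/g₀²Ṽ(g₀A). The vertices are represented by sums over almost local expressions, i.e. expressions
  involving field variables A localized to a union of several neighbouring blocks. They have at most eight legs, and
  the graphs have at most six vertices."*; p. 262: *"We localize vertices in big blocks by a decomposition of unity,
  and we expand the propagators C^{(0)}(Ω₁, U₁) into the generalized random walk expansion described in [5], Theorem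
  3.15, Theorem 3.10 and the preceding theorems."* … *"We estimate all such expressions using this bound and we get
  O(εᵏ)|T₁|. Summing the expressions with the same localization X we get finally the inequality*
  `∫dμ_{C^{(0)}(Ω₁,U₁)}(A)χ exp[𝓋(g₀A) − (1/g₀²)Ṽ(g₀A)] ≦ exp[Σ_X 𝒫′₁(g₀, X, U₁) + O(ε^{3+κ₀})|T₁|], (24)
  *where the sum is over localizations X which have diameter smaller than RM₁."*
* B10 p. 270: *"Thus these expansions and resummations give a non-local polynomial 𝒱(A), whose terms are described by
  (56). The integral on the right-hand side of (55) is estimated by*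
  `exp[Σ_{j=1}^{k} Σ_{Y_j} 𝒫_j(Y_j, U_{k+1}) + (the constants in (41))] × ∫dμ_{C^{(k)}}(A)χ exp[𝒱(A) +
  O((Lᵏε)^{3+κ₀})|T₁^{(k)}|]. (58)  *The integral above is calculated by the cumulant expansion up to the sixth order
  in g_k, the error being of the order O((Lᵏε)^{3+κ₀})|T₁^{(k)}|. Lower order terms are represented by graphs with
  vertices determined by the terms in (56), and with lines corresponding to the propagator C^{(k)}. We analyse the
  perturbative expressions in the same way as in the first step. We expand all the propagators into the generalized
  random walk expansions. We get a sum of terms, each having a localization domain X. Terms with localization domains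
  X having non-empty intersections with Ω^c_{k+1} are estimated by O(g_k)|Z_k|. Terms with domains X, which are not
  contained in a cube of the size R(g_k)M₁, are estimated by O((Lᵏε)^{3+κ₀})|T₁^{(k)}|. The remaining terms give the
  sum* `Σ_X 𝒫′_{k+1}(g_k, X, U_{k+1})` (59) *over localizations X ⊂ Ω_{k+1}, which are connected unions of big blocks,
  and which are contained in cubes of the size R(g_k)M₁."*; p. 265: *"The restrictions on A are introduced as in (18),
  and we perform the same operations on the whole lattice as on the sets Ω₁. They give the inequality"* (37)
  `ρ₁(V) ≧ χ₁ exp[−(1/g₁²)A^{L⁻¹}(U₁) + Σ_Y 𝒫₁(g₀, Y, U₁) − E₁ − O(ε^{3+κ₀})|T₁|]`; p. 272: *"The lower bound is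
  proved in the same way, with all simplifications coming from the fact that Ω_{k+1} = T_η."*
* B1 p. 616: *"To calculate the integral in the square bracket […] we use the cumulant expansion formula of the form*
  `⟨exp(V)⟩ = exp[⟨V⟩ + (1/2!)⟨V²⟩ᵀ + (1/3!)⟨V³⟩ᵀ + …]`, (3.23) *where ⟨·⟩ denotes the expectation value with respect
  to the measure dμ_{C^{(0)}}(A′)dμ_{C^{(0)}(B^{(1)})}(φ′), V = V^{(0)} and ⟨Vⁿ⟩ᵀ denotes the truncated expectation of a
  product of n polynomials V, thus* `⟨V²⟩ᵀ = ⟨V²⟩ − ⟨V⟩², ⟨V³⟩ᵀ = ⟨V³⟩ − 3⟨V²⟩⟨V⟩ + ⟨V⟩³`, ⟦sic — the last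
  coefficient is 2: `truncExp_three`, `printedThird_ne`⟧ *and so on. On the right side of (3.23) there is a formal
  series, so obviously we can use only some truncated form of this expansion. The coefficients of the polynomial V are
  proportional to some positive powers of ε. The smallest such power is ε^{1/2} and ⟨Vⁿ⟩ᵀ is the expression
  corresponding to the sum of connected graphs with exponentially decaying propagators. Hence ⟨Vⁿ⟩ᵀ = O(εᵏ)|T₁| with
  κ > d for n sufficiently large, e.g. n > 6. The terms of the formal series in (3.23) with n large are thus
  uninteresting for us and we would like to have a cumulant expansion formula in the form taking into account the
  existence of the characteristic functions also* `⟨χ exp(V)⟩ = exp[⟨V⟩ + (1/2!)⟨V²⟩ᵀ + … + (1/n̄!)⟨V^n̄⟩ᵀ +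
  O(εᵏ)|T₁|], κ > d. (3.24) *There is one obvious way of proving this formula, namely by a cluster expansion, but it is
  a long and tedious way. Instead we will rely on the results of Benfatto et al. [2]. The lemma formulated on p. 152
  of this paper can be applied in our situation because all the assumptions are satisfied. The method used by
  Gawędzki and Kupiainen in [14] can be adapted here also."*
* Secondary locator for the DEFINITION in (i) only: G. Gallavotti, Rev. Mod. Phys. 57 (1985) 471–562 [Gallavotti1985],
  (5.10) and (5.13) (held re-typeset text `paper:doi-10-1103-revmodphys-57-471`, file p0013; the held copy is not
  journal-paginated, so no page number is claimed).  Nothing of it is re-declared.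

WHAT IS KERNEL-CERTIFIED ([folklore] real analysis over Mathlib; throughout `ν` is a finite measure and `V` is
ν-a.e.-measurable with `|V| ≤ B` ν-a.e. — so every exponential moment exists and Mathlib's
"interior of `integrableExpSet`" hypotheses are discharged once, in §1):
* §1 `integrable_exp_mul_of_abs_le`, `integrableExpSet_eq_univ_of_abs_le`, `mgf_pos_of_abs_le`,
  `analyticAt_mgf_of_abs_le`, `analyticAt_cgf_of_abs_le`, `contDiff_cgf_of_abs_le`, `iteratedDeriv_mgf_zero_of_abs_le`
  (`Z⁽ⁿ⁾(0) = ∫ Vⁿ dν`), `cgf_one_eq` (`f(1) = log ∫ e^{V} dν`), `cgf_zero_eq` (`f(0) = log ν(univ)`).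
* §2 `nmoment` = ⟨Vⁿ⟩ (normalised moments), `truncExp` = ⟨Vⁿ⟩ᵀ := f⁽ⁿ⁾(0); `iteratedDeriv_succ_mgf` (Leibniz at every
  tilt t: `Z⁽ⁿ⁺¹⁾ = Σᵢ C(n,i) f⁽ⁱ⁺¹⁾ Z⁽ⁿ⁻ⁱ⁾`), `nmoment_succ` (the recursion behind "and so on":
  `⟨Vⁿ⁺¹⟩ = Σᵢ C(n,i) ⟨Vⁱ⁺¹⟩ᵀ ⟨Vⁿ⁻ⁱ⟩`), `truncExp_one` … `truncExp_four` (⟨V⟩; ⟨V²⟩ − ⟨V⟩²; ⟨V³⟩ − 3⟨V²⟩⟨V⟩ + 2⟨V⟩³;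
  ⟨V⁴⟩ − 4⟨V³⟩⟨V⟩ − 3⟨V²⟩² + 12⟨V²⟩⟨V⟩² − 6⟨V⟩⁴), `truncExp_const` + `printedThird_ne` (the misprint witness),
  `mgf_tilted_eq` / `cgf_tilted_eq` / `truncExp_tilted` (the truncated expectations of the TILTED law `e^{tV}ν/Z(t)` are
  the derivatives `f⁽ⁿ⁾(t)`), `deriv_cgf_eq_tilted_mean`, `iteratedDeriv_two_cgf_nonneg` (f is convex).
* §3 `cgf_taylor_lagrange` — `∃ θ ∈ (0,1), f(1) − f(0) = Σ_{n=1}^{N} ⟨Vⁿ⟩ᵀ/n! + f⁽ᴺ⁺¹⁾(θ)/(N+1)!`;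
  `abs_cgf_sub_sum_le` — `sup_{[0,1]} |f⁽ᴺ⁺¹⁾| ≤ R ⇒ |f(1) − f(0) − Σ_{n=1}^{N} ⟨Vⁿ⟩ᵀ/n!| ≤ R/(N+1)!`.
* §4 `cgf_zero_nonpos` (mass ≤ 1 ⇒ f(0) ≤ 0), `log_integral_exp_le` (UPPER half: no χ-volume), `le_log_integral_exp`
  (LOWER half: needs `log ν(univ) ≥ −W`); §4b the dictionary `chiMeasure μ χ = χ·μ`: `integral_chiMeasure`
  (`∫ g d(χμ) = ∫ χg dμ`), `chiMeasure_real_univ` (`(χμ)(univ) = ∫ χ dμ`), `chiMeasure_real_univ_le_one`,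
  `isFiniteMeasure_chiMeasure`, `neZero_chiMeasure`, `aemeasurable_chiMeasure`, `ae_chiMeasure_abs_le` (a bound on
  `{χ ≠ 0}` is a (χμ)-a.e. bound), and (3.24)'s two halves with the remainder NAMED: `log_integral_chi_exp_le`,
  `le_log_integral_chi_exp`.
* §5 `FluctuationModel.cumulant58_of : LocalizationUpper → CumulantRemainderBound → Cumulant58 P Cz (C₀ + C₁ + C₂)` and
  `FluctuationModel.cumulantLower_of : LocalizationLower → CumulantRemainderBound → SmallFieldVolume →
  CumulantLower P (C₀ + C₁ + C₂ + C₃)` — the (c)/(d) split of G-adv9-64 made a theorem: the volume of χ enters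
  downstairs only, as a separate input.

HYPOTHESIS SHAPES (never asserted; each a `def … : Prop` or a structure field, consumed as a binder):
`FluctuationModel` (the dictionary: `ν h U` finite, non-zero, of mass ≤ 1; `V h U` a.e. bounded; the seventh-order
Taylor remainder sandwich `logFl_le` / `le_logFl` — its calculus is `B10SectAGathering` §1, its analyticity inputs are
cell GAPS G-B10-04/05); `LocalizationUpper` / `LocalizationLower` (the random-walk localisation (23), (25), (59):
G-IF-04, G-B10-13 — INCLUDING the re-expansion of the χ-weighted truncated expectations about the Gaussian ones
printed in (3.24), and the ORDER BOOKKEEPING: print truncates BY ORDER IN g_k ("up to the sixth order in g_k"),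
(3.24) BY CUMULANT ORDER n̄; the terms of cumulant order ≤ N and g-order > 6 are O(rem)-terms that ride in `C₁·rem`);
`CumulantRemainderBound` (= G-adv5-3 PROPER, the owed lemma, now ONE displayed inequality:
`sup_{θ∈[0,1]} |⟨V^{N+1}⟩ᵀ_θ| ≤ C₂·(N+1)!·rem`); `SmallFieldVolume` (= G-adv9-64 (c)).

WHAT IS NOT CERTIFIED: any bound on `f⁽ᴺ⁺¹⁾` — the a-priori bound available from boundedness alone is
volume-useless (`sup |V|` grows like the volume), and (remark, not certified here) the full series (3.23) need not even
converge at t = 1: for the two-point law V = ±b, `f(t) = log cosh(bt)` has radius of convergence π/(2b) < 1 once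
b > π/2 — whence Taylor-with-remainder, not the series; the Gaussian / random-walk structure of `dμ_{C^{(k)}}` (B9;
G-IF-04); the construction of 𝒱 and 𝒫′ (G-B10-03 … 08); the identification of print's `∫dμ_{C^{(k)}}χ exp[…]` with an
instance of `FluctuationModel` (a reading, recorded in that structure's docstring); d = 4 (B10 is d = 3; every
statement here is d-independent).  Value = kernel bookkeeping of one by-reference DAG edge (B10 → B1 (3.24) → Benfatto
et al. 1978) modulo ONE located analytic leaf plus two already-recorded ones, and one misprint found — NOT summit
progress.

## References
* [Balaban1985UV3] T. Bałaban, Commun. Math. Phys. 102 (1985) 255–275 — (22) p. 261, (23)–(25) p. 262, (37) p. 265,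
  (58)–(59) p. 270, p. 272.
* [Balaban1982Higgs1] T. Bałaban, Commun. Math. Phys. 85 (1982) 603–636 — (3.23)–(3.24) p. 616.
* [Gallavotti1985] G. Gallavotti, Rev. Mod. Phys. 57 (1985) 471–562 — (5.10), (5.13): definition locator only.
* Benfatto, Cassandro, Gallavotti, Nicolò, Olivieri, Presutti, Scacciatelli, Commun. Math. Phys. 59 (1978) 143–166,
  "the lemma formulated on p. 152" — NOT held (acq-07983), not quoted, not used.
-/

open MeasureTheory ProbabilityTheory Filter Topology
open scoped BigOperators ENNReal NNReal Nat

namespace Literature.MathematicalPhysics.QuantumFieldTheory.Balaban1983to89.B10Eq24Cumulant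

/-! ## §1  Generic: a bounded random variable under a finite measure (every exponential moment exists) -/

section Generic

variable {Ω : Type*} {mΩ : MeasurableSpace Ω} {V : Ω → ℝ} {ν : Measure Ω} {B : ℝ}

variable [IsFiniteMeasure ν]

/-- For `|V| ≤ B` ν-a.e. under a finite measure every exponential moment `∫ e^{tV} dν` exists. [folklore] -/
theorem integrable_exp_mul_of_abs_le (hV : AEMeasurable V ν) (hB : ∀ᵐ ω ∂ν, |V ω| ≤ B) (t : ℝ) :
    Integrable (fun ω => Real.exp (t * V ω)) ν :=
  integrable_exp_mul_of_mem_Icc hV (hB.mono fun _ hω => abs_le.mp hω)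

/-- … i.e. `integrableExpSet V ν = ℝ`. [folklore] -/
theorem integrableExpSet_eq_univ_of_abs_le (hV : AEMeasurable V ν) (hB : ∀ᵐ ω ∂ν, |V ω| ≤ B) :
    integrableExpSet V ν = Set.univ :=
  Set.eq_univ_of_forall fun t => integrable_exp_mul_of_abs_le hV hB t

/-- … so every real `t` is interior to `integrableExpSet V ν` (the standing hypothesis of Mathlib's `mgf`/`cgf`
calculus). [folklore] -/
theorem mem_interior_integrableExpSet_of_abs_le (hV : AEMeasurable V ν) (hB : ∀ᵐ ω ∂ν, |V ω| ≤ B) (t : ℝ) :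
    t ∈ interior (integrableExpSet V ν) := by
  rw [integrableExpSet_eq_univ_of_abs_le hV hB, interior_univ]
  exact Set.mem_univ t

/-- `Z(t) = mgf V ν t > 0` for a non-zero measure. [folklore] -/
theorem mgf_pos_of_abs_le [NeZero ν] (hV : AEMeasurable V ν) (hB : ∀ᵐ ω ∂ν, |V ω| ≤ B) (t : ℝ) :
    0 < mgf V ν t :=
  mgf_pos' (NeZero.ne ν) (integrable_exp_mul_of_abs_le hV hB t)

/-- `Z = mgf V ν` is real-analytic at every point. [folklore] -/
theorem analyticAt_mgf_of_abs_le (hV : AEMeasurable V ν) (hB : ∀ᵐ ω ∂ν, |V ω| ≤ B) (t : ℝ) :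
    AnalyticAt ℝ (mgf V ν) t :=
  analyticAt_mgf (mem_interior_integrableExpSet_of_abs_le hV hB t)

/-- `f = cgf V ν = log ∘ Z` is real-analytic at every point. [folklore] -/
theorem analyticAt_cgf_of_abs_le (hV : AEMeasurable V ν) (hB : ∀ᵐ ω ∂ν, |V ω| ≤ B) (t : ℝ) :
    AnalyticAt ℝ (cgf V ν) t :=
  analyticAt_cgf (mem_interior_integrableExpSet_of_abs_le hV hB t)

/-- … hence `C^n` for every `n`. [folklore] -/
theorem contDiff_cgf_of_abs_le (hV : AEMeasurable V ν) (hB : ∀ᵐ ω ∂ν, |V ω| ≤ B) {n : WithTop ℕ∞} :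
    ContDiff ℝ n (cgf V ν) :=
  contDiff_iff_contDiffAt.2 fun t => (analyticAt_cgf_of_abs_le hV hB t).contDiffAt

/-- `Z(1) = ∫ e^{V} dν` and `Z(0) = ν(univ)`, `f(1) = log ∫ e^{V} dν`, `f(0) = log ν(univ)` (the two ends of the
interpolation `t ↦ log ∫ e^{tV} dν`). [folklore] -/
theorem mgf_one_eq (V : Ω → ℝ) (ν : Measure Ω) : mgf V ν 1 = ∫ ω, Real.exp (V ω) ∂ν := by
  simp [mgf]

/-- `f(1) = log ∫ e^{V} dν` — the left end of B1 (3.24) (before dividing by the mass). [folklore] -/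
theorem cgf_one_eq (V : Ω → ℝ) (ν : Measure Ω) : cgf V ν 1 = Real.log (∫ ω, Real.exp (V ω) ∂ν) := by
  simp [cgf, mgf]

/-- `f(0) = log ν(univ)` — for `ν = χ·μ` this is `log⟨χ⟩`, the volume of the characteristic functions. [folklore] -/
theorem cgf_zero_eq (V : Ω → ℝ) (ν : Measure Ω) : cgf V ν 0 = Real.log (ν.real Set.univ) := cgf_zero'

/-- The derivatives of `Z` are the (un-normalised) tilted moments `Z⁽ⁿ⁾(t) = ∫ Vⁿ e^{tV} dν`, in particular
`Z⁽ⁿ⁾(0) = ∫ Vⁿ dν` (Mathlib, made unconditional for bounded `V`). [folklore] -/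
theorem iteratedDeriv_mgf_of_abs_le (hV : AEMeasurable V ν) (hB : ∀ᵐ ω ∂ν, |V ω| ≤ B) (n : ℕ) (t : ℝ) :
    iteratedDeriv n (mgf V ν) t = ∫ ω, V ω ^ n * Real.exp (t * V ω) ∂ν :=
  iteratedDeriv_mgf (mem_interior_integrableExpSet_of_abs_le hV hB t) n

/-- `Z⁽ⁿ⁾(0) = ∫ Vⁿ dν` (the un-normalised moments). [folklore] -/
theorem iteratedDeriv_mgf_zero_of_abs_le (hV : AEMeasurable V ν) (hB : ∀ᵐ ω ∂ν, |V ω| ≤ B) (n : ℕ) :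
    iteratedDeriv n (mgf V ν) 0 = ∫ ω, V ω ^ n ∂ν := by
  rw [iteratedDeriv_mgf_of_abs_le hV hB n 0]
  refine integral_congr_ae (Eventually.of_forall fun ω => ?_)
  simp

/-! ## §2  The truncated expectations `⟨Vⁿ⟩ᵀ` of B1 (3.23): definition as Taylor coefficients of `log⟨e^{tV}⟩`,
## the moment–cumulant recursion, the displayed low orders, and "tilting = shifting" -/

/-- The NORMALISED MOMENTS `⟨Vⁿ⟩ := (∫ Vⁿ dν) / ν(univ)` (B1 p. 616: «⟨·⟩ denotes the expectation value with respect
to the measure …»; for the χ-weighted measure `ν = χ·μ` of §4 this is `⟨χVⁿ⟩/⟨χ⟩`). [folklore] -/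
noncomputable def nmoment (V : Ω → ℝ) (ν : Measure Ω) (n : ℕ) : ℝ :=
  (∫ ω, V ω ^ n ∂ν) / ν.real Set.univ

/-- The TRUNCATED EXPECTATIONS `⟨Vⁿ⟩ᵀ` of B1 (3.23), DEFINED (as (3.23) itself defines them: «⟨exp(V)⟩ = exp[⟨V⟩ +
(1/2!)⟨V²⟩ᵀ + (1/3!)⟨V³⟩ᵀ + …]», a formal series) as `n!` times the n-th Taylor coefficient at `0` of
`t ↦ log ∫ e^{tV} dν`, i.e. the n-th derivative at `0` of the cumulant generating function `cgf V ν`. [folklore] -/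
noncomputable def truncExp (V : Ω → ℝ) (ν : Measure Ω) (n : ℕ) : ℝ :=
  iteratedDeriv n (cgf V ν) 0

/-- Unfolding lemma for `truncExp`. [folklore] -/
theorem truncExp_def (V : Ω → ℝ) (ν : Measure Ω) (n : ℕ) : truncExp V ν n = iteratedDeriv n (cgf V ν) 0 := rfl

/-- `⟨V⁰⟩ = 1` for a non-zero finite measure. [folklore] -/
theorem nmoment_zero [NeZero ν] (V : Ω → ℝ) : nmoment V ν 0 = 1 := by
  simp [nmoment, measureReal_univ_ne_zero]

/-- `Z' = f'·Z` on all of ℝ. [folklore] -/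
theorem deriv_mgf_eq_deriv_cgf_mul [NeZero ν] (hV : AEMeasurable V ν) (hB : ∀ᵐ ω ∂ν, |V ω| ≤ B) (t : ℝ) :
    deriv (mgf V ν) t = deriv (cgf V ν) t * mgf V ν t := by
  have ht := mem_interior_integrableExpSet_of_abs_le hV hB t
  have hne : mgf V ν t ≠ 0 := (mgf_pos_of_abs_le hV hB t).ne'
  rw [deriv_cgf ht, deriv_mgf ht, div_mul_cancel₀ _ hne]

/-- THE MOMENT–CUMULANT RECURSION (Leibniz on `Z' = f'Z`), at every tilt `t`:
`Z⁽ⁿ⁺¹⁾(t) = Σ_{i=0}^{n} C(n,i) f⁽ⁱ⁺¹⁾(t) Z⁽ⁿ⁻ⁱ⁾(t)`. [folklore] -/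
theorem iteratedDeriv_succ_mgf [NeZero ν] (hV : AEMeasurable V ν) (hB : ∀ᵐ ω ∂ν, |V ω| ≤ B) (n : ℕ) (t : ℝ) :
    iteratedDeriv (n + 1) (mgf V ν) t = ∑ i ∈ Finset.range (n + 1),
      (n.choose i : ℝ) * iteratedDeriv (i + 1) (cgf V ν) t * iteratedDeriv (n - i) (mgf V ν) t := by
  have hfun : deriv (mgf V ν) = fun s => deriv (cgf V ν) s * mgf V ν s :=
    funext fun s => deriv_mgf_eq_deriv_cgf_mul hV hB s
  have h1 : ContDiffAt ℝ n (deriv (cgf V ν)) t := ((analyticAt_cgf_of_abs_le hV hB t).deriv).contDiffAt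
  have h2 : ContDiffAt ℝ n (mgf V ν) t := (analyticAt_mgf_of_abs_le hV hB t).contDiffAt
  calc iteratedDeriv (n + 1) (mgf V ν) t = iteratedDeriv n (deriv (mgf V ν)) t := by
        rw [iteratedDeriv_succ']
    _ = iteratedDeriv n (fun s => deriv (cgf V ν) s * mgf V ν s) t := by rw [hfun]
    _ = ∑ i ∈ Finset.range (n + 1),
          (n.choose i : ℝ) * iteratedDeriv i (deriv (cgf V ν)) t * iteratedDeriv (n - i) (mgf V ν) t :=
        iteratedDeriv_fun_mul h1 h2
    _ = _ := Finset.sum_congr rfl fun i _ => by rw [← iteratedDeriv_succ']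

/-- … normalised and at `t = 0`: `⟨Vⁿ⁺¹⟩ = Σ_{i=0}^{n} C(n,i) ⟨Vⁱ⁺¹⟩ᵀ ⟨Vⁿ⁻ⁱ⟩` — the recursion that (3.23) abbreviates
by «and so on». [folklore] -/
theorem nmoment_succ [NeZero ν] (hV : AEMeasurable V ν) (hB : ∀ᵐ ω ∂ν, |V ω| ≤ B) (n : ℕ) :
    nmoment V ν (n + 1) = ∑ i ∈ Finset.range (n + 1),
      (n.choose i : ℝ) * truncExp V ν (i + 1) * nmoment V ν (n - i) := by
  have h := iteratedDeriv_succ_mgf hV hB n 0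
  simp only [iteratedDeriv_mgf_zero_of_abs_le hV hB] at h
  unfold nmoment truncExp
  rw [h, Finset.sum_div]
  refine Finset.sum_congr rfl fun i _ => ?_
  ring

/-- `⟨V⟩ᵀ = ⟨V⟩`. [folklore] -/
theorem truncExp_one [NeZero ν] (hV : AEMeasurable V ν) (hB : ∀ᵐ ω ∂ν, |V ω| ≤ B) :
    truncExp V ν 1 = nmoment V ν 1 := by
  have h1 := nmoment_succ hV hB 0
  simp only [Finset.sum_range_succ, Finset.sum_range_zero, zero_add, Nat.choose_self, Nat.cast_one, one_mul,
    Nat.sub_self, nmoment_zero, mul_one] at h1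
  exact h1.symm

/-- `⟨V²⟩ᵀ = ⟨V²⟩ − ⟨V⟩²` (B1 p. 616, first displayed formula). [folklore] -/
theorem truncExp_two [NeZero ν] (hV : AEMeasurable V ν) (hB : ∀ᵐ ω ∂ν, |V ω| ≤ B) :
    truncExp V ν 2 = nmoment V ν 2 - nmoment V ν 1 ^ 2 := by
  have h1 := truncExp_one hV hB
  have h2 := nmoment_succ hV hB 1
  simp only [Finset.sum_range_succ, Finset.sum_range_zero, zero_add, Nat.choose_zero_right, Nat.choose_self,
    Nat.cast_one, one_mul, Nat.sub_zero, Nat.sub_self, nmoment_zero, mul_one, Nat.reduceAdd] at h2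
  rw [h1] at h2
  linear_combination (-1 : ℝ) * h2

/-- `⟨V³⟩ᵀ = ⟨V³⟩ − 3⟨V²⟩⟨V⟩ + 2⟨V⟩³` — the CORRECT third truncated expectation.  B1 p. 616 PRINTS
«⟨V³⟩ᵀ = ⟨V³⟩ − 3⟨V²⟩⟨V⟩ + ⟨V⟩³» (coefficient 1 instead of 2 on `⟨V⟩³`): a misprint, immaterial to the paper (no
coefficient of (3.23) is ever used numerically), witnessed false by `printedThird_ne` below. [folklore] -/
theorem truncExp_three [NeZero ν] (hV : AEMeasurable V ν) (hB : ∀ᵐ ω ∂ν, |V ω| ≤ B) :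
    truncExp V ν 3 = nmoment V ν 3 - 3 * nmoment V ν 2 * nmoment V ν 1 + 2 * nmoment V ν 1 ^ 3 := by
  have h1 := truncExp_one hV hB
  have h2 := truncExp_two hV hB
  have h3 := nmoment_succ hV hB 2
  have c21 : Nat.choose 2 1 = 2 := by decide
  simp only [Finset.sum_range_succ, Finset.sum_range_zero, zero_add, Nat.choose_zero_right, Nat.choose_self, c21,
    Nat.cast_one, Nat.cast_ofNat, one_mul, Nat.sub_zero, Nat.sub_self, nmoment_zero, mul_one, Nat.reduceAdd,
    Nat.reduceSub] at h3
  rw [h1, h2] at h3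
  linear_combination (-1 : ℝ) * h3

/-- `⟨V⁴⟩ᵀ = ⟨V⁴⟩ − 4⟨V³⟩⟨V⟩ − 3⟨V²⟩² + 12⟨V²⟩⟨V⟩² − 6⟨V⟩⁴`. [folklore] -/
theorem truncExp_four [NeZero ν] (hV : AEMeasurable V ν) (hB : ∀ᵐ ω ∂ν, |V ω| ≤ B) :
    truncExp V ν 4 = nmoment V ν 4 - 4 * nmoment V ν 3 * nmoment V ν 1 - 3 * nmoment V ν 2 ^ 2
      + 12 * nmoment V ν 2 * nmoment V ν 1 ^ 2 - 6 * nmoment V ν 1 ^ 4 := by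
  have h1 := truncExp_one hV hB
  have h2 := truncExp_two hV hB
  have h3 := truncExp_three hV hB
  have h4 := nmoment_succ hV hB 3
  have c31 : Nat.choose 3 1 = 3 := by decide
  have c32 : Nat.choose 3 2 = 3 := by decide
  simp only [Finset.sum_range_succ, Finset.sum_range_zero, zero_add, Nat.choose_zero_right, Nat.choose_self, c31,
    c32, Nat.cast_one, Nat.cast_ofNat, one_mul, Nat.sub_zero, Nat.sub_self, nmoment_zero, mul_one, Nat.reduceAdd,
    Nat.reduceSub] at h4
  rw [h1, h2, h3] at h4
  linear_combination (-1 : ℝ) * h4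

/-- The moments of a deterministic `V ≡ c` under a probability measure: `⟨Vⁿ⟩ = cⁿ`. [folklore] -/
theorem nmoment_const {ν : Measure Ω} [IsProbabilityMeasure ν] (c : ℝ) (n : ℕ) :
    nmoment (fun _ : Ω => c) ν n = c ^ n := by
  simp [nmoment]

/-- … and its truncated expectations of order `≥ 2` vanish (`log⟨e^{tc}⟩ = tc` is linear). [folklore] -/
theorem truncExp_const {ν : Measure Ω} [IsProbabilityMeasure ν] (c : ℝ) {n : ℕ} (hn : 2 ≤ n) :
    truncExp (fun _ : Ω => c) ν n = 0 := by
  have h : cgf (fun _ : Ω => c) ν = fun t => t * c := funext fun t => cgf_const c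
  have h0 : n ≠ 0 := by omega
  have h1 : n ≠ 1 := by omega
  rw [truncExp, h, iteratedDeriv_mul_const_field, iteratedDeriv_fun_id]
  simp [h0, h1]

/-- KERNEL WITNESS that the PRINTED third formula of B1 p. 616, «⟨V³⟩ − 3⟨V²⟩⟨V⟩ + ⟨V⟩³», is NOT the third truncated
expectation: for the deterministic `V ≡ 1` on a one-point probability space `⟨V³⟩ᵀ = 0` while the printed right side
is `1 − 3 + 1 = −1` (the correct `+ 2⟨V⟩³` gives `0`).  Cell DIVERGENCE D-b10.19; harmless for [Balaban1982Higgs1] /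
[Balaban1985UV3], which use (3.23) only through its truncated-with-remainder form (3.24). [folklore] -/
theorem printedThird_ne :
    truncExp (fun _ : Unit => (1 : ℝ)) (Measure.dirac ()) 3 ≠
      nmoment (fun _ : Unit => (1 : ℝ)) (Measure.dirac ()) 3
        - 3 * nmoment (fun _ : Unit => (1 : ℝ)) (Measure.dirac ()) 2
            * nmoment (fun _ : Unit => (1 : ℝ)) (Measure.dirac ()) 1
        + nmoment (fun _ : Unit => (1 : ℝ)) (Measure.dirac ()) 1 ^ 3 := by
  rw [truncExp_const 1 (by norm_num : 2 ≤ 3), nmoment_const, nmoment_const, nmoment_const]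
  norm_num

omit [IsFiniteMeasure ν] in
/-- TILTING = SHIFTING.  The exponential moments of `V` under the TILTED (interpolating) law
`ν_t = e^{tV}ν / Z(t)` are `Z(s + t)/Z(t)`. [folklore] -/
theorem mgf_tilted_eq (t s : ℝ) :
    mgf V (ν.tilted fun ω => t * V ω) s = mgf V ν (s + t) / mgf V ν t := by
  simp only [mgf, integral_tilted, smul_eq_mul]
  rw [← integral_div]
  refine integral_congr_ae (Eventually.of_forall fun ω => ?_)
  simp only [add_mul, Real.exp_add]
  ring

/-- … so the cumulant generating function of the tilted law is the SHIFTED one: `f_t(s) = f(s + t) − f(t)`.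
[folklore] -/
theorem cgf_tilted_eq [NeZero ν] (hV : AEMeasurable V ν) (hB : ∀ᵐ ω ∂ν, |V ω| ≤ B) (t s : ℝ) :
    cgf V (ν.tilted fun ω => t * V ω) s = cgf V ν (s + t) - cgf V ν t := by
  simp only [cgf]
  rw [mgf_tilted_eq t s, Real.log_div (mgf_pos_of_abs_le hV hB (s + t)).ne' (mgf_pos_of_abs_le hV hB t).ne']

/-- … hence `f⁽ⁿ⁾(t)` IS the n-th truncated expectation `⟨Vⁿ⟩ᵀ_t` of `V` under the tilted law `e^{tV}ν/Z(t)`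
(`n ≥ 1`) — the interpolating-measure reading of every coefficient and of the remainder in §3. [folklore] -/
theorem truncExp_tilted [NeZero ν] (hV : AEMeasurable V ν) (hB : ∀ᵐ ω ∂ν, |V ω| ≤ B) (t : ℝ) {n : ℕ}
    (hn : n ≠ 0) : truncExp V (ν.tilted fun ω => t * V ω) n = iteratedDeriv n (cgf V ν) t := by
  have h : cgf V (ν.tilted fun ω => t * V ω) = fun s => (-cgf V ν t) + cgf V ν (s + t) :=
    funext fun s => by rw [cgf_tilted_eq hV hB t s]; ring
  rw [truncExp, h, iteratedDeriv_const_add (Nat.pos_of_ne_zero hn), iteratedDeriv_comp_add_const n (cgf V ν) t]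
  simp

/-- The first two tilted truncated expectations are the tilted MEAN and VARIANCE (Mathlib):
`f'(t) = ∫ V dν_t`, `f''(t) = ∫ (V − f'(t))² e^{tV} dν / Z(t) ≥ 0`. [folklore] -/
theorem deriv_cgf_eq_tilted_mean (hV : AEMeasurable V ν) (hB : ∀ᵐ ω ∂ν, |V ω| ≤ B) (t : ℝ) :
    deriv (cgf V ν) t = ∫ ω, V ω ∂(ν.tilted fun ω => t * V ω) :=
  (integral_tilted_mul_self (mem_interior_integrableExpSet_of_abs_le hV hB t)).symm

/-- `f'' ≥ 0`: the second tilted truncated expectation is a variance, so `f = log Z` is convex. [folklore] -/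
theorem iteratedDeriv_two_cgf_nonneg (hV : AEMeasurable V ν) (hB : ∀ᵐ ω ∂ν, |V ω| ≤ B) (t : ℝ) :
    0 ≤ iteratedDeriv 2 (cgf V ν) t := by
  rw [iteratedDeriv_two_cgf_eq_integral (mem_interior_integrableExpSet_of_abs_le hV hB t)]
  exact div_nonneg (integral_nonneg fun ω => mul_nonneg (sq_nonneg _) (Real.exp_nonneg _)) mgf_nonneg

/-! ## §3  The EXACT truncated cumulant expansion: Taylor–Lagrange for `f = log Z` on `[0, 1]` -/

/-- Taylor polynomial of a smooth function at `0`, evaluated at `1`, in `iteratedDeriv` form. [folklore] -/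
theorem taylorWithinEval_eq_sum {f : ℝ → ℝ} (hf : ∀ m : ℕ, ContDiffAt ℝ m f 0) (N : ℕ) :
    taylorWithinEval f N (Set.Icc 0 1) 0 1 = ∑ k ∈ Finset.range (N + 1), iteratedDeriv k f 0 / k ! := by
  rw [taylor_within_apply]
  refine Finset.sum_congr rfl fun k _ => ?_
  rw [iteratedDerivWithin_eq_iteratedDeriv uniqueDiffOn_Icc_zero_one (hf k) ⟨le_rfl, zero_le_one⟩, smul_eq_mul,
    sub_zero, one_pow, mul_one, inv_mul_eq_div]

/-- **THE CUMULANT EXPANSION WITH LAGRANGE REMAINDER** (B1 (3.24) as an IDENTITY, for every truncation order `N`):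
`log ∫e^{V}dν − log ν(univ) = Σ_{n=1}^{N} ⟨Vⁿ⟩ᵀ/n! + f⁽ᴺ⁺¹⁾(θ)/(N+1)!` for some `θ ∈ (0, 1)`, where by `truncExp_tilted`
the remainder coefficient `f⁽ᴺ⁺¹⁾(θ)` is the `(N+1)`-st truncated expectation of `V` under the interpolating law
`e^{θV}ν/Z(θ)`.  Nothing but Taylor's theorem for the real-analytic `f = cgf V ν`; the CONTENT of (3.24) — that this
remainder is `O(εᵏ)|T₁|`, VOLUME-LINEAR — is the cluster-expansion input named in §5, not proved here. [folklore] -/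
theorem cgf_taylor_lagrange (hV : AEMeasurable V ν) (hB : ∀ᵐ ω ∂ν, |V ω| ≤ B) (N : ℕ) :
    ∃ θ ∈ Set.Ioo (0 : ℝ) 1, cgf V ν 1 - cgf V ν 0 =
      (∑ n ∈ Finset.range N, truncExp V ν (n + 1) / (n + 1)!) +
        iteratedDeriv (N + 1) (cgf V ν) θ / (N + 1)! := by
  have hana : ∀ t, AnalyticAt ℝ (cgf V ν) t := fun t => analyticAt_cgf_of_abs_le hV hB t
  have hcd : ContDiffOn ℝ (N + 1) (cgf V ν) (Set.uIcc 0 1) :=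
    fun t _ => ((hana t).contDiffAt).contDiffWithinAt
  obtain ⟨θ, hθ, h⟩ := taylor_mean_remainder_lagrange_iteratedDeriv (zero_ne_one : (0 : ℝ) ≠ 1) hcd
  rw [Set.uIoo_of_le zero_le_one] at hθ
  refine ⟨θ, hθ, ?_⟩
  rw [Set.uIcc_of_le zero_le_one, taylorWithinEval_eq_sum (fun m => (hana 0).contDiffAt) N,
    Finset.sum_range_succ'] at h
  simp only [iteratedDeriv_zero, Nat.factorial_zero, Nat.cast_one, div_one, sub_zero, one_pow, mul_one] at h
  simp only [truncExp]
  linarith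

/-- … as a TWO-SIDED BOUND: if `|f⁽ᴺ⁺¹⁾| ≤ R` on `[0, 1]` then
`|log ∫e^{V}dν − log ν(univ) − Σ_{n=1}^{N} ⟨Vⁿ⟩ᵀ/n!| ≤ R/(N+1)!`. [folklore] -/
theorem abs_cgf_sub_sum_le (hV : AEMeasurable V ν) (hB : ∀ᵐ ω ∂ν, |V ω| ≤ B) (N : ℕ) {R : ℝ}
    (hR : ∀ θ ∈ Set.Icc (0 : ℝ) 1, |iteratedDeriv (N + 1) (cgf V ν) θ| ≤ R) :
    |cgf V ν 1 - cgf V ν 0 - ∑ n ∈ Finset.range N, truncExp V ν (n + 1) / (n + 1)!| ≤ R / (N + 1)! := by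
  obtain ⟨θ, hθ, h⟩ := cgf_taylor_lagrange hV hB N
  rw [h, add_sub_cancel_left, abs_div, Nat.abs_cast]
  exact div_le_div_of_nonneg_right (hR θ ⟨hθ.1.le, hθ.2.le⟩) (Nat.cast_nonneg _)

/-! ## §4  The χ-bookkeeping: total mass `≤ 1` costs nothing upstairs, the volume of χ is needed downstairs -/

omit [IsFiniteMeasure ν] in
/-- `ν(univ) ≤ 1 ⇒ f(0) = log ν(univ) ≤ 0`. [folklore] -/
theorem cgf_zero_nonpos (V : Ω → ℝ) (hmass : ν.real Set.univ ≤ 1) : cgf V ν 0 ≤ 0 := by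
  rw [cgf_zero']
  exact Real.log_nonpos measureReal_nonneg hmass

/-- UPPER HALF (the direction of B10 (24)/(58), which are «≦» only): for `ν(univ) ≤ 1` (ν = χ·μ, μ a probability
measure, `0 ≤ χ ≤ 1`) NO lower bound on the mass of χ is needed:
`log ∫ e^{V} dν ≤ Σ_{n=1}^{N} ⟨Vⁿ⟩ᵀ/n! + R/(N+1)!`. [folklore] -/
theorem log_integral_exp_le (hV : AEMeasurable V ν) (hB : ∀ᵐ ω ∂ν, |V ω| ≤ B) (hmass : ν.real Set.univ ≤ 1)
    (N : ℕ) {R : ℝ} (hR : ∀ θ ∈ Set.Icc (0 : ℝ) 1, |iteratedDeriv (N + 1) (cgf V ν) θ| ≤ R) :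
    Real.log (∫ ω, Real.exp (V ω) ∂ν) ≤ (∑ n ∈ Finset.range N, truncExp V ν (n + 1) / (n + 1)!) + R / (N + 1)! := by
  have h := (abs_le.mp (abs_cgf_sub_sum_le hV hB N hR)).2
  have h0 := cgf_zero_nonpos V hmass
  rw [← cgf_one_eq]
  linarith

/-- LOWER HALF (the direction of B10 (37)/(47)): it needs, in addition, a lower bound `log ν(univ) ≥ −W` on the mass
of χ — for the Gaussian small-field characteristic function of (22)/(51) this is cell GAPS G-adv9-64 (c), the tree
theorem `B10Eq47Volume.volume47_real_ge` (GIVEN Šidák): `Σ_{n=1}^{N} ⟨Vⁿ⟩ᵀ/n! − R/(N+1)! − W ≤ log ∫ e^{V} dν`.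
[folklore] -/
theorem le_log_integral_exp (hV : AEMeasurable V ν) (hB : ∀ᵐ ω ∂ν, |V ω| ≤ B) (N : ℕ) {R W : ℝ}
    (hR : ∀ θ ∈ Set.Icc (0 : ℝ) 1, |iteratedDeriv (N + 1) (cgf V ν) θ| ≤ R)
    (hW : -W ≤ Real.log (ν.real Set.univ)) :
    (∑ n ∈ Finset.range N, truncExp V ν (n + 1) / (n + 1)!) - R / (N + 1)! - W
      ≤ Real.log (∫ ω, Real.exp (V ω) ∂ν) := by
  have h := (abs_le.mp (abs_cgf_sub_sum_le hV hB N hR)).1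
  rw [← cgf_one_eq, ← cgf_zero_eq V ν] at *
  linarith

end Generic

/-! ### §4b  The dictionary `ν = χ·μ`: `∫ g d(χ·μ) = ∫ χ g dμ`, mass `⟨χ⟩ ≤ 1`, a.e.-bounds on `{χ ≠ 0}`,
### and B1 (3.24) in its two halves with the remainder NAMED -/

section ChiWeighted

variable {Ω : Type*} {mΩ : MeasurableSpace Ω} {μ : Measure Ω} {χ V : Ω → ℝ} {B : ℝ}

/-- The χ-weighted measure `χ·μ` (B1/B10's `⟨χ ·⟩` before normalisation: the Gaussian measure times the product
`χ` of small-field characteristic functions, `0 ≤ χ ≤ 1`). [folklore] -/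
noncomputable def chiMeasure (μ : Measure Ω) (χ : Ω → ℝ) : Measure Ω :=
  μ.withDensity fun ω => ENNReal.ofReal (χ ω)

/-- `∫ g d(χ·μ) = ∫ χ·g dμ` — B1/B10's `⟨χ g⟩` (un-normalised). [folklore] -/
theorem integral_chiMeasure (hχm : Measurable χ) (hχ0 : ∀ ω, 0 ≤ χ ω) (g : Ω → ℝ) :
    ∫ ω, g ω ∂(chiMeasure μ χ) = ∫ ω, χ ω * g ω ∂μ := by
  rw [chiMeasure, integral_withDensity_eq_integral_toReal_smul hχm.ennreal_ofReal
    (Eventually.of_forall fun _ => ENNReal.ofReal_lt_top)]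
  refine integral_congr_ae (Eventually.of_forall fun ω => ?_)
  simp only [ENNReal.toReal_ofReal (hχ0 ω), smul_eq_mul]

/-- The total mass of `χ·μ` is `⟨χ⟩ = ∫ χ dμ`. [folklore] -/
theorem chiMeasure_real_univ (hχm : Measurable χ) (hχ0 : ∀ ω, 0 ≤ χ ω) :
    (chiMeasure μ χ).real Set.univ = ∫ ω, χ ω ∂μ := by
  rw [measureReal_def, chiMeasure, withDensity_apply _ MeasurableSet.univ, Measure.restrict_univ,
    integral_eq_lintegral_of_nonneg_ae (Eventually.of_forall hχ0) hχm.aestronglyMeasurable]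

/-- `χ·μ` is a finite measure for `0 ≤ χ ≤ 1` and `μ` finite. [folklore] -/
theorem isFiniteMeasure_chiMeasure [IsFiniteMeasure μ] (hχm : Measurable χ) (hχ0 : ∀ ω, 0 ≤ χ ω)
    (hχ1 : ∀ ω, χ ω ≤ 1) : IsFiniteMeasure (chiMeasure μ χ) := by
  have hint : Integrable χ μ :=
    (integrable_const (1 : ℝ)).mono' hχm.aestronglyMeasurable
      (Eventually.of_forall fun ω => by rw [Real.norm_eq_abs, abs_of_nonneg (hχ0 ω)]; exact hχ1 ω)
  exact isFiniteMeasure_withDensity_ofReal hint.hasFiniteIntegral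

/-- `⟨χ⟩ ≤ 1` for `0 ≤ χ ≤ 1` under a probability measure — the only property of χ the UPPER half uses.
[folklore] -/
theorem chiMeasure_real_univ_le_one [IsProbabilityMeasure μ] (hχm : Measurable χ) (hχ0 : ∀ ω, 0 ≤ χ ω)
    (hχ1 : ∀ ω, χ ω ≤ 1) : (chiMeasure μ χ).real Set.univ ≤ 1 := by
  rw [chiMeasure_real_univ hχm hχ0]
  have hint : Integrable χ μ :=
    (integrable_const (1 : ℝ)).mono' hχm.aestronglyMeasurable
      (Eventually.of_forall fun ω => by rw [Real.norm_eq_abs, abs_of_nonneg (hχ0 ω)]; exact hχ1 ω)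
  calc ∫ ω, χ ω ∂μ ≤ ∫ _, (1 : ℝ) ∂μ := integral_mono hint (integrable_const 1) hχ1
    _ = 1 := by simp

/-- `⟨χ⟩ > 0 ⇒ χ·μ ≠ 0` (needed only for the NORMALISED moments `nmoment` and the low-order formulas of §2, not
for the two halves of (3.24) below). [folklore] -/
theorem neZero_chiMeasure (hχm : Measurable χ) (hχ0 : ∀ ω, 0 ≤ χ ω) (hpos : 0 < ∫ ω, χ ω ∂μ) :
    NeZero (chiMeasure μ χ) := by
  refine ⟨fun h => ?_⟩
  have h1 := chiMeasure_real_univ (μ := μ) hχm hχ0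
  rw [h] at h1
  simp only [Measure.real, Measure.coe_zero, Pi.zero_apply, ENNReal.toReal_zero] at h1
  linarith

/-- An everywhere bound on `{χ ≠ 0}` is an a.e. bound for `χ·μ` (B10: `V` is a polynomial in the fields, bounded
only where the small-field characteristic functions do not vanish). [folklore] -/
theorem ae_chiMeasure_abs_le (hχm : Measurable χ) (hVB : ∀ ω, χ ω ≠ 0 → |V ω| ≤ B) :
    ∀ᵐ ω ∂(chiMeasure μ χ), |V ω| ≤ B := by
  rw [chiMeasure, ae_withDensity_iff hχm.ennreal_ofReal]
  refine Eventually.of_forall fun ω hω => hVB ω fun h0 => hω ?_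
  simp [h0]

/-- μ-a.e.-measurability passes to `χ·μ ≪ μ`. [folklore] -/
theorem aemeasurable_chiMeasure (hVm : AEMeasurable V μ) : AEMeasurable V (chiMeasure μ χ) :=
  hVm.mono_ac (withDensity_absolutelyContinuous _ _)

/-- **B1 (3.24), UPPER HALF, remainder named**: for a probability measure `μ`, a measurable `0 ≤ χ ≤ 1` (no
positivity of `⟨χ⟩` needed: at `⟨χ⟩ = 0` both sides degenerate consistently, `log 0 = 0` in Mathlib), and `V`
μ-a.e.-measurable with `|V| ≤ B` on `{χ ≠ 0}`:
`log⟨χ e^{V}⟩ ≤ Σ_{n=1}^{N} ⟨Vⁿ⟩ᵀ_χ/n! + R/(N+1)!` whenever `|f⁽ᴺ⁺¹⁾| ≤ R` on `[0,1]`, `f(t) = log⟨χe^{tV}⟩` — the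
truncated expectations being those of the normalised χ-weighted law.  (3.24)'s `O(εᵏ)|T₁|` is the assertion
`R/(N+1)! ≤ O(εᵏ)|T₁|` (plus the re-expansion of `⟨·⟩ᵀ_χ` about the unweighted Gaussian ⟨·⟩ of (3.24)), i.e. the
§5 leaves. [folklore] -/
theorem log_integral_chi_exp_le [IsProbabilityMeasure μ] (hχm : Measurable χ) (hχ0 : ∀ ω, 0 ≤ χ ω)
    (hχ1 : ∀ ω, χ ω ≤ 1) (hVm : AEMeasurable V μ)
    (hVB : ∀ ω, χ ω ≠ 0 → |V ω| ≤ B) (N : ℕ) {R : ℝ}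
    (hR : ∀ θ ∈ Set.Icc (0 : ℝ) 1, |iteratedDeriv (N + 1) (cgf V (chiMeasure μ χ)) θ| ≤ R) :
    Real.log (∫ ω, χ ω * Real.exp (V ω) ∂μ)
      ≤ (∑ n ∈ Finset.range N, truncExp V (chiMeasure μ χ) (n + 1) / (n + 1)!) + R / (N + 1)! := by
  haveI := isFiniteMeasure_chiMeasure (μ := μ) hχm hχ0 hχ1
  rw [← integral_chiMeasure hχm hχ0]
  exact log_integral_exp_le (aemeasurable_chiMeasure hVm) (ae_chiMeasure_abs_le hχm hVB)
    (chiMeasure_real_univ_le_one hχm hχ0 hχ1) N hR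

/-- **B1 (3.24), LOWER HALF, remainder named**: the same data give
`Σ_{n=1}^{N} ⟨Vⁿ⟩ᵀ_χ/n! − R/(N+1)! + log⟨χ⟩ ≤ log⟨χ e^{V}⟩` — the lower half needs the VOLUME `log⟨χ⟩` of the
characteristic functions (for B10's Gaussian small-field χ: G-adv9-64 (c), tree `B10Eq47Volume`). [folklore] -/
theorem le_log_integral_chi_exp [IsProbabilityMeasure μ] (hχm : Measurable χ) (hχ0 : ∀ ω, 0 ≤ χ ω)
    (hχ1 : ∀ ω, χ ω ≤ 1) (hVm : AEMeasurable V μ)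
    (hVB : ∀ ω, χ ω ≠ 0 → |V ω| ≤ B) (N : ℕ) {R : ℝ}
    (hR : ∀ θ ∈ Set.Icc (0 : ℝ) 1, |iteratedDeriv (N + 1) (cgf V (chiMeasure μ χ)) θ| ≤ R) :
    (∑ n ∈ Finset.range N, truncExp V (chiMeasure μ χ) (n + 1) / (n + 1)!) - R / (N + 1)!
      + Real.log (∫ ω, χ ω ∂μ) ≤ Real.log (∫ ω, χ ω * Real.exp (V ω) ∂μ) := by
  haveI := isFiniteMeasure_chiMeasure (μ := μ) hχm hχ0 hχ1
  rw [← integral_chiMeasure hχm hχ0, ← chiMeasure_real_univ hχm hχ0]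
  have h := le_log_integral_exp (aemeasurable_chiMeasure hVm) (ae_chiMeasure_abs_le hχm hVB) N hR
    (W := -Real.log ((chiMeasure μ χ).real Set.univ)) (by simp)
  linarith

end ChiWeighted

/-! ## §5  The B10-facing wrapper: (24) p. 262 / (58)–(59) p. 270 as bookkeeping over NAMED leaves -/

section B10

open Literature.MathematicalPhysics.QuantumFieldTheory.Balaban1983to89.B10
open Literature.MathematicalPhysics.QuantumFieldTheory.Balaban1983to89.B10SectAGathering

variable {T : TowerRun} {k : ℕ} {P : StepPieces T k} {Ω : Type*} [MeasurableSpace Ω]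

/-- DICTIONARY (data + the two printed sandwich sentences; a HYPOTHESIS SHAPE, never asserted): the fluctuation
integral of one step — the last factor `∫dμ_{C^{(0)}(Ω₁,U₁)}(A)χ exp[v(g₀A) − (1/g₀²)Ṽ(g₀A)]` of (22) p. 261 (k = 0)
/ «The integral on the right-hand side of (55)» = `∫dμ_{C^{(k)}}(A)χ exp[𝒱(A) + O((Lᵏε)^{3+κ₀})|T₁^{(k)}|]` of (58)
p. 270 — presented, per level-(k+1) history `h` and configuration `U`, as the χ-weighted exponential moment of a
potential `V h U` (= the expansion «up to the sixth order (or higher) in g₀» of `v(g₀A) − g₀⁻²Ṽ(g₀A)`, p. 261–262 / the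
«non-local polynomial 𝒱(A)» of p. 270) under a finite non-zero measure `ν h U` of total mass `≤ 1` (= χ·dμ_{C^{(k)}},
the Gaussian measure being a probability measure and `0 ≤ χ ≤ 1`; §4b), ν-a.e. bounded (V is a polynomial in fields
confined by χ); `logFl_le` / `le_logFl` = the seventh-order Taylor remainder «O(g₀⁷p¹⁸(g₀))|Ω₁| ≦ O(ε^{3+κ₀})|T₁|»
(p. 262 line 1) resp. «the overall factor is (g_kp(g_k))⁷ … we get O((Lᵏε)^{3+κ₀})|B(Λ_{k+1})|» (p. 270) moved out of
the exponent: `P.logFl` within `± C₀·rem` of `log ∫ e^{V} dν` (upper for every history, lower at the trivial one —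
the only history of (37)/(47)).  `N` = the truncation order BY CUMULANT ORDER, (3.24)'s n̄ (print: «up to the sixth
order in g_k», BY ORDER IN g_k: with N = 6 and every vertex of g-order ≥ 1, cumulant order > 6 forces g-order > 6, so
those terms are inside `CumulantRemainderBound`; the converse surplus — cumulant order ≤ 6, g-order > 6 — rides in the
localisation leaf's `C₁·rem`).
[cite: Balaban1985UV3, (22) p.261 + (24) p.262 + (58) p.270] -/
structure FluctuationModel (P : StepPieces T k) (Ω : Type*) [MeasurableSpace Ω] where
  ν : T.Hist (k + 1) → T.Cfg (k + 1) → Measure Ω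
  fin : ∀ h U, IsFiniteMeasure (ν h U)
  ne : ∀ h U, NeZero (ν h U)
  mass_le_one : ∀ h U, (ν h U).real Set.univ ≤ 1
  V : T.Hist (k + 1) → T.Cfg (k + 1) → Ω → ℝ
  V_ae : ∀ h U, AEMeasurable (V h U) (ν h U)
  bd : T.Hist (k + 1) → T.Cfg (k + 1) → ℝ
  V_le : ∀ h U, ∀ᵐ ω ∂(ν h U), |V h U ω| ≤ bd h U
  N : ℕ
  C₀ : ℝ
  logFl_le : ∀ h U, P.logFl h U ≤ Real.log (∫ ω, Real.exp (V h U ω) ∂(ν h U)) + C₀ * P.rem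
  le_logFl : ∀ U, Real.log (∫ ω, Real.exp (V (T.triv (k + 1)) U ω) ∂(ν (T.triv (k + 1)) U)) - C₀ * P.rem
    ≤ P.logFl (T.triv (k + 1)) U

namespace FluctuationModel

variable (M : FluctuationModel P Ω)

/-- The order-`N` perturbative sum `Σ_{n=1}^{N} ⟨Vⁿ⟩ᵀ/n!` of the step («Lower order terms are represented by graphs
with vertices determined by the terms in (56), and with lines corresponding to the propagator C^{(k)}», p. 270;
«lower order connected vacuum graphs», p. 262). [folklore] -/
noncomputable def pertSum (h : T.Hist (k + 1)) (U : T.Cfg (k + 1)) : ℝ :=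
  ∑ n ∈ Finset.range M.N, truncExp (M.V h U) (M.ν h U) (n + 1) / (n + 1)!

/-- LEAF (hypothesis shape, never asserted) — the LOCALISATION bookkeeping of p. 262 («We localize vertices in big
blocks by a decomposition of unity, and we expand the propagators C^{(0)}(Ω₁, U₁) into the generalized random walk
expansion … (23) … Summing the expressions with the same localization X we get finally the inequality (24)») and of
p. 270 («Terms with localization domains X having non-empty intersections with Ω_{k+1}ᶜ are estimated by O(g_k)|Z_k|.
Terms with domains X, which are not contained in a cube of the size R(g_k)M₁, are estimated by
O((Lᵏε)^{3+κ₀})|T₁^{(k)}|.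
The remaining terms give the sum (59) Σ_X 𝒫′_{k+1}(g_k, X, U_{k+1})»): the perturbative sum is the localized sum
`P.PprU` up to `Cz·g_k·|Z_k| + C₁·rem` (cell GAPS G-IF-04, G-B10-13; the rate (25) is `B10Eq25Rate`).
[cite: Balaban1985UV3, (23)–(24) p.262 + (59) p.270] -/
def LocalizationUpper (Cz C₁ : ℝ) : Prop :=
  ∀ (h : T.Hist (k + 1)) (U : T.Cfg (k + 1)), M.pertSum h U ≤ P.PprU h U + Cz * T.g k * P.Zvol h + C₁ * P.rem

/-- LEAF (hypothesis shape) — the same localisation bookkeeping in the lower direction at the trivial history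
(p. 265 «we perform the same operations on the whole lattice as on the sets Ω₁»; p. 272 «The lower bound is proved in
the same way»; no Z_k-term: Ω_{k+1} = T_η). [cite: Balaban1985UV3, p.265 + p.272] -/
def LocalizationLower (C₁ : ℝ) : Prop :=
  ∀ U : T.Cfg (k + 1), P.PprU (T.triv (k + 1)) U - C₁ * P.rem ≤ M.pertSum (T.triv (k + 1)) U

/-- LEAF (hypothesis shape, never asserted) — **the cumulant lemma proper** (cell GAPS G-adv5-3): the VOLUME-LINEAR
bound on the interpolated `(N+1)`-st truncated expectation, `sup_{θ∈[0,1]} |⟨V^{N+1}⟩ᵀ_θ| ≤ C₂·(N+1)!·rem` — B1 p. 616: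
«⟨Vⁿ⟩ᵀ is the expression corresponding to the sum of connected graphs with exponentially decaying propagators. Hence
⟨Vⁿ⟩ᵀ = O(εᵏ)|T₁| with κ > d for n sufficiently large, e.g. n > 6.» and «There is one obvious way of proving this
formula, namely by a cluster expansion, but it is a long and tedious way. Instead we will rely on the results of
Benfatto et al. [2]. The lemma formulated on p. 152 of this paper can be applied in our situation because all the
assumptions are satisfied. The method used by Gawędzki and Kupiainen in [14] can be adapted here also.» — whose
hypotheses (exponential decay of the covariance, almost-locality and g-order of the vertices, the product structure
of χ) are displayed in neither B1 nor B10.  A leaf, not a claim. [cite: Balaban1982Higgs1, (3.24) p.616] -/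
def CumulantRemainderBound (C₂ : ℝ) : Prop :=
  ∀ (h : T.Hist (k + 1)) (U : T.Cfg (k + 1)), ∀ θ ∈ Set.Icc (0 : ℝ) 1,
    |iteratedDeriv (M.N + 1) (cgf (M.V h U) (M.ν h U)) θ| ≤ C₂ * (M.N + 1)! * P.rem

/-- LEAF (hypothesis shape) — the small-field VOLUME at the trivial history, `log ν(univ) = log⟨χ⟩ ≥ −C₃·rem`
(cell GAPS G-adv9-64 (c); for the Gaussian small-field χ of (22)/(51) this is the tree theorem
`B10Eq47Volume.volume47_real_ge`, GIVEN Šidák's inequality). [cite: Balaban1985UV3, (37) p.265 + (47) p.267] -/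
def SmallFieldVolume (C₃ : ℝ) : Prop :=
  ∀ U : T.Cfg (k + 1), -(C₃ * P.rem) ≤ Real.log ((M.ν (T.triv (k + 1)) U).real Set.univ)

/-- Arithmetic: `C₂·(N+1)!·rem/(N+1)! = C₂·rem`. [folklore] -/
theorem remainder_div (C₂ : ℝ) :
    C₂ * ((M.N + 1)! : ℝ) * P.rem / (M.N + 1)! = C₂ * P.rem := by
  have hf : ((M.N + 1)! : ℝ) ≠ 0 := Nat.cast_ne_zero.2 (Nat.factorial_ne_zero _)
  rw [div_eq_iff hf]
  ring

/-- **(24) p. 262 / (58)–(59) p. 270 as BOOKKEEPING**: the dictionary, the localisation leaf and the cumulant leaf give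
the typed leaf `B10SectAGathering.Cumulant58 P Cz (C₀ + C₁ + C₂)` — with NO hypothesis on the volume of χ (total mass
`≤ 1` suffices upstairs: `cgf_zero_nonpos`).  Kernel-checked composition of `log_integral_exp_le`; every analytic
input stays a named hypothesis. [cite: Balaban1985UV3, (24) p.262 + (58)–(59) p.270] -/
theorem cumulant58_of {Cz C₁ C₂ : ℝ} (hL : M.LocalizationUpper Cz C₁) (hR : M.CumulantRemainderBound C₂) :
    Cumulant58 P Cz (M.C₀ + C₁ + C₂) := by
  intro h U
  haveI := M.fin h U
  haveI := M.ne h U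
  have h1 := log_integral_exp_le (M.V_ae h U) (M.V_le h U) (M.mass_le_one h U) M.N (hR h U)
  rw [remainder_div] at h1
  have h2 := hL h U
  have h3 := M.logFl_le h U
  simp only [pertSum] at h2
  linarith

/-- **The lower direction at the trivial history** ((37) p. 265 / p. 272): dictionary + localisation leaf + cumulant
leaf + the small-field VOLUME leaf give `B10SectAGathering.CumulantLower P (C₀ + C₁ + C₂ + C₃)` — the (c)/(d) split
of cell GAPS G-adv9-64 made a theorem: downstairs the volume of χ is a genuine, separate input.
[cite: Balaban1985UV3, (37) p.265 + (47) p.267 + p.272] -/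
theorem cumulantLower_of {C₁ C₂ C₃ : ℝ} (hL : M.LocalizationLower C₁) (hR : M.CumulantRemainderBound C₂)
    (hW : M.SmallFieldVolume C₃) : CumulantLower P (M.C₀ + C₁ + C₂ + C₃) := by
  intro U
  haveI := M.fin (T.triv (k + 1)) U
  haveI := M.ne (T.triv (k + 1)) U
  have h1 := le_log_integral_exp (M.V_ae _ U) (M.V_le _ U) M.N (hR (T.triv (k + 1)) U) (hW U)
  rw [remainder_div] at h1
  have h2 := hL U
  have h3 := M.le_logFl U
  simp only [pertSum] at h2
  linarith

end FluctuationModel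

end B10

end Literature.MathematicalPhysics.QuantumFieldTheory.Balaban1983to89.B10Eq24Cumulant
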